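import Literature.Geometry.Riemannian.DeTurckFieldRegularity
import Literature.Geometry.Manifold.TimeDependentFlowIcc
import HarnessLib

/-!
# Short-time existence of the Ricci flow, reduced to the Ricci–DeTurck flow (Topping 2006, §5.2)
(topic `Geometry/Riemannian`)

Final assembly of the proved existence-direction DeTurck reduction of the named fact
`Literature.Geometry.Riemannian.ricciFlow_shortTime_existence` (`RicciFlow.lean`; Hamilton 1982,
Thm. 4.2; Topping 2006, Thm. 5.2.1): of the two hypotheses of
`ricciFlow_shortTime_existence_of_deTurck'` (`DeTurckFieldRegularity.lean`) — (RDT-existence)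
and (flows of time-dependent vector fields on closed manifolds) — the second is now a theorem
(`Literature.Geometry.Manifold.exists_timeDepFlow_Icc`, `TimeDependentFlowIcc.lean`: Lee 2012,
Thm. 9.48, through Seeley extension in time and the tree's global flows, Hirsch 1976, Ch. 8 §1,
Thms. 1.1–1.2), so that

* `ricciFlow_shortTime_existence_of_ricciDeTurck` — **`ricciFlow_shortTime_existence` follows
  from short-time existence of the Ricci–DeTurck flow alone**: for every `C^∞` Riemannian metric
  `g₀` on a closed manifold and every Levi-Civita connection `bg` of `g₀`, a Ricci–DeTurck flow
  `(g, cov)` relative to `bg` (`IsRicciDeTurckFlow`, `RicciDeTurckFlow.lean`; Andrews–Hopper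
  2011, (5.10)) on some `[0, ε]`, `ε > 0`, smooth on `M × [0, ε]`, with `g 0 = g₀` — Topping
  2006, §5.2, Step 1 with (5.2.2) ("the equation `∂g/∂t = P(g)` is parabolic ... there exist
  `ε > 0` and a solution `g(t)`, `t ∈ [0, ε]`, `g(0) = g₀`", by the quasilinear parabolic theory
  of §4.4), the one analytic input that neither Mathlib nor the tree has.

Everything here is proved; no named fact is introduced. The chain: Step 2 (i) `W` is smooth
(`contMDiffOn_deTurckField`), (ii) `X = -W` generates `ψ_t` (`exists_timeDepFlow_Icc`),
(iii)–(iv) `ĝ_t = ψ_t^* g_t` is a Ricci flow with `ĝ_0 = g₀` (`IsContMDiffFamilyOn.pullbackBilin`,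
Prop. 1.2.1 `hasDerivWithinAt_val_pullback_family`, `ricci_comap_apply`), Riemannian by
signature persistence (`RicciFlowProofs.lean`).

## References

* P. Topping, *Lectures on the Ricci flow*, LMS LNS 325 (2006), §5.2, Steps 1–2, (5.2.2),
  Thm. 5.2.1. [Topping2006]
* R. S. Hamilton, *Three-manifolds with positive Ricci curvature*, J. Differential Geom. 17
  (1982), Thm. 4.2. [Hamilton1982]
* D. M. DeTurck, *Deforming metrics in the direction of their Ricci tensors*, J. Differential
  Geom. 18 (1983). [DeTurck1983]
* J. M. Lee, *Introduction to Smooth Manifolds*, 2nd ed. (2012), Thm. 9.48. [Lee2012]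
-/

noncomputable section

open Bundle Set Filter Function
open scoped Manifold ContDiff Topology

namespace Literature.Geometry.Riemannian

open Lorentzian Lorentzian.PseudoRiemannianMetric Literature.Geometry.Manifold

universe u v w

/-- **Short-time existence of the Ricci flow from short-time existence of the Ricci–DeTurck
flow** (Topping 2006, §5.2: Step 1 ⇒ Thm. 5.2.1 via Step 2; DeTurck 1983; Hamilton 1982,
Thm. 4.2). ASSUME (RDT-existence) `hRE`: on every closed `C^∞` manifold with
finite-dimensional complete boundaryless model, for every `C^∞` Riemannian metric `g₀` and every
Levi-Civita connection `bg` of `g₀` there are `ε > 0` and a Ricci–DeTurck flow `(g, cov)`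
relative to `bg` on `[0, ε]` (smooth on `M × [0, ε]`, `cov t` Levi-Civita for `g t`,
`∂_t g = -2Ric(g) + ℒ_W g`) with `g 0 = g₀` — Topping §5.2, Step 1, (5.2.2). THEN the named
fact `ricciFlow_shortTime_existence` holds: `ricciFlow_shortTime_existence_of_deTurck'` with the
flow hypothesis discharged by `exists_timeDepFlow_Icc` (Lee 2012, Thm. 9.48). This reduces the
fact to its parabolic core. [cite: Topping2006, §5.2, Step 1, (5.2.2) and Thm. 5.2.1]
[cite: DeTurck1983] -/
theorem ricciFlow_shortTime_existence_of_ricciDeTurck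
    (hRE : ∀ {E : Type u} [NormedAddCommGroup E] [NormedSpace ℝ E] [FiniteDimensional ℝ E]
      [CompleteSpace E] {H : Type v} [TopologicalSpace H] (I : ModelWithCorners ℝ E H)
      [I.Boundaryless] (M : Type w) [TopologicalSpace M] [T2Space M] [SecondCountableTopology M]
      [CompactSpace M] [ChartedSpace H M] [IsManifold I ∞ M]
      (g₀ : PseudoRiemannianMetric I ∞ E (TangentSpace I : M → Type _)), g₀.IsRiemannian →
      ∀ (bg : CovariantDerivative I E (TangentSpace I : M → Type _)), g₀.IsLeviCivita bg →
      ∃ ε : ℝ, 0 < ε ∧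
        ∃ (g : ℝ → PseudoRiemannianMetric I ∞ E (TangentSpace I : M → Type _))
          (cov : ℝ → CovariantDerivative I E (TangentSpace I : M → Type _)),
          IsRicciDeTurckFlow g cov bg (Icc 0 ε) ∧ g 0 = g₀) :
    ricciFlow_shortTime_existence.{u, v, w} :=
  ricciFlow_shortTime_existence_of_deTurck' hRE fun I _ M _ _ _ _ _ _ _ hε _ hV ↦
    exists_timeDepFlow_Icc I M hε hV

end Literature.Geometry.Riemannian
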